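import Mathlib
import Literature.NumberTheory.LFunctions.Zhang2022.Section10cLamAvgSecondLine
import Literature.NumberTheory.LFunctions.Zhang2022.Section10cLow1214Int
import Literature.NumberTheory.LFunctions.Zhang2022.Section8AbelProfiles
import Literature.NumberTheory.LFunctions.Zhang2022.Section10DirectCalculation
import HarnessLib

/-!
# Zhang (2022) §10c: the "second line" of the top range of `S_j(𝐚₁₂,𝐚₁₄)` (DAG node Z22:§10.u057 (ii))

Topic `Literature/NumberTheory/LFunctions/Zhang2022` (Landau–Siegel audit tree; verdict-neutral).
Y. Zhang, *Discrete mean estimates and the Landau–Siegel zero*, arXiv:2211.02515v1 (2022)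
[Zhang2022LandauSiegel], §10 p. 61 (display at tex L3101, first → second line) — **an unrefereed
manuscript under adjudication; this file asserts nothing about its Theorems 1–2 or about
Landau–Siegel zeros.** D-0069 campaign, discharge layer L3 (seat sz-d39; L3 LEDGER #15 (2)).

What is PROVED here (kernel-checked, theorem-only, no new definitions or facts):

* the engine is `Typed.Sec10C.lamAvg_second_line` (Section10cLamAvgSecondLine, unconditional: "the
  results in Section 8" in the derivable form `lamAvg_rule` of sz-d34, the substitution `x = P^z`,
  `𝔞 = 𝔠_D L′(1,χ)²`, `|L′(1,χ)| ≪ 𝓛²`; error `O(𝓛⁻¹²) = o(α)`);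
* `y2Profile_bounds`, `topProfile_bounds` — the profile `t ↦ 𝔣_{j7}(P^{0.5}/t)(1 + 𝔶_{2j}(P^{0.004}t))`
  is `C¹` on `[P^{0.498}, P^{0.5} + 1]` with `‖·‖ ≤ 4669`, `‖d/dt‖ ≤ 17222α/t`.
* `top1214Int_holds : Top1214Int c′` — **Z22:§10.u057 (ii) [Z22 p.61, tex L3101, second line]
  HOLDS as typed**: "`… = (1000ῑ₄𝔞/log P)∫₀^{0.002}𝔣𝔣_{j7}(z)(1 + 𝔶𝔶_{2j}(0.504 − z))dz + o(α)`"
  (main values `𝔣_{j7}(P^{0.5−z}) = 𝔣𝔣_{j7}(0.5 − z) + O(𝓛⁻⁸)` — sz-d34's `norm_frakf_sub_ffJ` — and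
  `𝔶_{2j}(P^{z+0.004}) = 𝔶𝔶_{2j}(z + 0.004) + O(𝓛⁻⁸)` — `Typed.Sec10A.step10u024_holds` (Z22:§10.u024);
  substitution `u = 0.5 − z`).

## References

* Y. Zhang, arXiv:2211.02515v1 (2022), §10 p. 61; §8 p. 48–49; §2 (2.13), (2.22), (2.26), (2.31).
  [cite: Zhang2022LandauSiegel, §10 p. 61]
-/

noncomputable section

open Complex Real ComplexConjugate MeasureTheory
open Literature.NumberTheory.LFunctions.Zhang2022.Skeleton

namespace Literature.NumberTheory.LFunctions.Zhang2022.Typed.Sec10C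

section D39Top1214Int

/-! ### The profile of the top range of `S_j(𝐚₁₂,𝐚₁₄)` -/

/-- `P^{0.504}/(P^{0.004}t) = P^{0.5}/t`. [cite: Zhang2022LandauSiegel, §10 p. 61] -/
theorem rpow504_div (D : ℕ) (t : ℝ) :
    bigP D ^ (0.504 : ℝ) / (bigP D ^ (0.004 : ℝ) * t) = bigP D ^ (0.5 : ℝ) / t := by
  have hP : 0 < bigP D := Real.exp_pos _
  rw [← div_div, ← Real.rpow_sub hP]
  norm_num

/-- **`t ↦ 1 + 𝔶_{2j}(P^{0.004}t)` on `[1, P]`** (`𝔶_{2j}` of (10.10) is the quadratic polynomial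
`(β_{j+1}+β_{j+2})L + ½β_{j+1}β_{j+2}L²` in `L = log(P^{0.5}/t)`): differentiable,
`‖1 + 𝔶_{2j}(P^{0.004}t)‖ ≤ 161`, `‖(d/dt)(1 + 𝔶_{2j}(P^{0.004}t))‖ ≤ 72α/t`, provided `5|c′|α𝓛 ≤ 1`
(so `‖β_k‖ ≤ 4α`) and `α log P ≤ 4` (so `α|L| ≤ 4`). [cite: Zhang2022LandauSiegel, §10 (10.10), p. 61] -/
theorem y2Profile_bounds (c' : ℝ) {D : ℕ} (j : ℕ) {t : ℝ} (hα : 0 < alpha D) (hℓ : 0 ≤ ell D)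
    (hc : 5 * |c'| * alpha D * ell D ≤ 1) (ht1 : 1 ≤ t) (htP : t ≤ bigP D)
    (hΛ4 : alpha D * Real.log (bigP D) ≤ 4) (hQ1 : 1 ≤ bigP D ^ (0.5 : ℝ))
    (hQP : bigP D ^ (0.5 : ℝ) ≤ bigP D) :
    DifferentiableAt ℝ (fun u : ℝ => 1 + fraky2 c' D j (bigP D ^ (0.004 : ℝ) * u)) t ∧
      ‖1 + fraky2 c' D j (bigP D ^ (0.004 : ℝ) * t)‖ ≤ 161 ∧
      ‖deriv (fun u : ℝ => 1 + fraky2 c' D j (bigP D ^ (0.004 : ℝ) * u)) t‖ ≤ 72 * alpha D / t := by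
  have ht : 0 < t := by linarith
  set Q : ℝ := bigP D ^ (0.5 : ℝ) with hQ
  have hQ0 : 0 < Q := by linarith
  set S : ℂ := betaJ c' D (j + 1) + betaJ c' D (j + 2) with hS
  set Pr : ℂ := betaJ c' D (j + 1) * betaJ c' D (j + 2) with hPr
  set g : ℂ → ℂ := fun L => 1 + S * L + Pr / 2 * L ^ 2 with hg
  have hfun : (fun u : ℝ => 1 + fraky2 c' D j (bigP D ^ (0.004 : ℝ) * u)) =
      fun u => g ((Real.log (Q / u) : ℝ) : ℂ) := by
    funext u
    simp only [hg, fraky2, rpow504_div, hS, hPr, hQ]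
    ring
  have hg' : ∀ L : ℂ, HasDerivAt g (S + Pr * L) L := by
    intro L
    have h1 : HasDerivAt (fun L : ℂ => S * L) S L := by
      simpa using (hasDerivAt_id L).const_mul S
    have h2 : HasDerivAt (fun L : ℂ => L ^ 2) (2 * L) L := by
      simpa using hasDerivAt_pow 2 L
    have h3 := (h1.add (h2.const_mul (Pr / 2))).const_add 1
    refine (h3.congr_of_eventuallyEq (Filter.Eventually.of_forall fun x => ?_)).congr_deriv (by ring)
    simp only [hg, Pi.add_apply]
    ring
  have hd : HasDerivAt (fun u : ℝ => g ((Real.log (Q / u) : ℝ) : ℂ))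
      (-((S + Pr * ((Real.log (Q / t) : ℝ) : ℂ))) * (t : ℂ)⁻¹) t :=
    Section8AbelProfiles.hasDerivAt_comp_log_div hg' hQ0 ht
  -- sizes
  have hL : |Real.log (Q / t)| ≤ Real.log (bigP D) :=
    Section8AbelProfiles.abs_log_div_le hQ1 hQP ht1 htP
  have hαL : alpha D * |Real.log (Q / t)| ≤ 4 := (mul_le_mul_of_nonneg_left hL hα.le).trans hΛ4
  have hβ1 := Section8AbelProfiles.norm_betaJ_le c' hα.le hℓ hc (j + 1)
  have hβ2 := Section8AbelProfiles.norm_betaJ_le c' hα.le hℓ hc (j + 2)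
  have hSn : ‖S‖ ≤ 8 * alpha D := (norm_add_le _ _).trans (by linarith)
  have hPrn : ‖Pr‖ ≤ (4 * alpha D) * (4 * alpha D) := by
    rw [hPr, norm_mul]; exact mul_le_mul hβ1 hβ2 (norm_nonneg _) (by positivity)
  have hLn : ‖((Real.log (Q / t) : ℝ) : ℂ)‖ = |Real.log (Q / t)| := by
    rw [Complex.norm_real, Real.norm_eq_abs]
  set ℓt : ℝ := |Real.log (Q / t)| with hℓt
  have hℓt0 : 0 ≤ ℓt := abs_nonneg _
  have hgval : ‖g ((Real.log (Q / t) : ℝ) : ℂ)‖ ≤ 161 := by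
    simp only [hg]
    calc ‖1 + S * ((Real.log (Q / t) : ℝ) : ℂ) + Pr / 2 * ((Real.log (Q / t) : ℝ) : ℂ) ^ 2‖
        ≤ ‖(1 : ℂ)‖ + ‖S * ((Real.log (Q / t) : ℝ) : ℂ)‖ +
            ‖Pr / 2 * ((Real.log (Q / t) : ℝ) : ℂ) ^ 2‖ := norm_add₃_le
      _ = 1 + ‖S‖ * ℓt + ‖Pr‖ / 2 * ℓt ^ 2 := by
          rw [norm_one, norm_mul, norm_mul, norm_div, norm_pow, hLn, hℓt]
          norm_num
      _ ≤ 1 + 8 * alpha D * ℓt + (4 * alpha D) * (4 * alpha D) / 2 * ℓt ^ 2 := by gcongr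
      _ = 1 + 8 * (alpha D * ℓt) + 8 * (alpha D * ℓt) ^ 2 := by ring
      _ ≤ 1 + 8 * 4 + 8 * 4 ^ 2 := by gcongr
      _ = 161 := by norm_num
  have hg'val : ‖S + Pr * ((Real.log (Q / t) : ℝ) : ℂ)‖ ≤ 72 * alpha D := by
    calc ‖S + Pr * ((Real.log (Q / t) : ℝ) : ℂ)‖ ≤ ‖S‖ + ‖Pr‖ * ℓt := by
          refine (norm_add_le _ _).trans ?_; rw [norm_mul, hLn]
      _ ≤ 8 * alpha D + (4 * alpha D) * (4 * alpha D) * ℓt := by gcongr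
      _ = 8 * alpha D + 16 * alpha D * (alpha D * ℓt) := by ring
      _ ≤ 8 * alpha D + 16 * alpha D * 4 := by gcongr
      _ = 72 * alpha D := by ring
  refine ⟨by rw [hfun]; exact hd.differentiableAt, ?_, ?_⟩
  · show ‖(fun u : ℝ => 1 + fraky2 c' D j (bigP D ^ (0.004 : ℝ) * u)) t‖ ≤ 161
    rw [hfun]; exact hgval
  · rw [hfun, hd.deriv, norm_mul, norm_neg, norm_inv, Complex.norm_real, Real.norm_eq_abs,
      abs_of_pos ht, ← div_eq_mul_inv]
    exact div_le_div_of_nonneg_right hg'val ht.le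

/-- **The top-range profile `t ↦ 𝔣_{j7}(P^{0.5}/t)(1 + 𝔶_{2j}(P^{0.004}t))` on `[1, P]`**: differentiable,
`‖·‖ ≤ 4669 = 29·161`, `‖d/dt‖ ≤ 17222α/t` (product rule with `Section8AbelProfiles.frakfW_div_bounds`
and `y2Profile_bounds`). [cite: Zhang2022LandauSiegel, §10 p. 61] -/
theorem topProfile_bounds (c' : ℝ) {D : ℕ} (j : ℕ) {t : ℝ} (hα : 0 < alpha D) (hℓ : 0 ≤ ell D)
    (hc : 5 * |c'| * alpha D * ell D ≤ 1) (ht1 : 1 ≤ t) (htP : t ≤ bigP D)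
    (hΛ4 : alpha D * Real.log (bigP D) ≤ 4) (hQ1 : 1 ≤ bigP D ^ (0.5 : ℝ))
    (hQP : bigP D ^ (0.5 : ℝ) ≤ bigP D) :
    DifferentiableAt ℝ (fun u : ℝ => frakfW c' D j 7 (bigP D ^ (0.5 : ℝ) / u) *
        (1 + fraky2 c' D j (bigP D ^ (0.004 : ℝ) * u))) t ∧
      ‖frakfW c' D j 7 (bigP D ^ (0.5 : ℝ) / t) * (1 + fraky2 c' D j (bigP D ^ (0.004 : ℝ) * t))‖
          ≤ 4669 ∧
      ‖deriv (fun u : ℝ => frakfW c' D j 7 (bigP D ^ (0.5 : ℝ) / u) *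
          (1 + fraky2 c' D j (bigP D ^ (0.004 : ℝ) * u))) t‖ ≤ 17222 * alpha D / t := by
  obtain ⟨hfd, hfn, hfd'⟩ := Section8AbelProfiles.frakfW_div_bounds c' j 7 hα hℓ hc hQ1 hQP ht1 htP
    hΛ4
  obtain ⟨hgd, hgn, hgd'⟩ := y2Profile_bounds c' j hα hℓ hc ht1 htP hΛ4 hQ1 hQP
  obtain ⟨h1, h2, h3⟩ := Section8AbelProfiles.mul_bounds hfd hgd hfn hgn hfd' hgd' (by norm_num)
  refine ⟨h1, h2.trans (by norm_num), h3.trans (le_of_eq ?_)⟩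
  ring

/-! ### Main values and sizes at `t = P^z` -/

/-- `𝔶𝔶_{2j}` applied: the selector commutes with evaluation. [cite: Zhang2022LandauSiegel, §10 p. 57] -/
theorem yyJ2_apply (j : ℕ) (w : ℝ) :
    yyJ2 j w = if j = 1 then yy21 w else if j = 2 then yy22 w else yy23 w := by
  unfold yyJ2 byJ
  split_ifs <;> rfl

/-- `‖𝔣𝔣_{a,k}(w)‖ ≤ 1 + |a|π|w|` (`𝔣𝔣_{a,k}(w) = (1 + aπiw)e^{kπiw}`). [cite: Zhang2022LandauSiegel, §8 (8.13)–(8.18)] -/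
theorem norm_ffF_le (a k : ℚ) (w : ℝ) : ‖ffF a k w‖ ≤ 1 + |(a : ℝ)| * π * |w| := by
  have e : cexp (k * π * I * w) = cexp (((k * π * w : ℝ)) * I) := by push_cast; ring_nf
  rw [ffF, norm_mul, e, Complex.norm_exp_ofReal_mul_I, mul_one]
  calc ‖1 + (a : ℂ) * π * I * w‖ ≤ ‖(1 : ℂ)‖ + ‖(a : ℂ) * π * I * w‖ := norm_add_le _ _
    _ = 1 + |(a : ℝ)| * π * |w| := by
        rw [norm_one, norm_mul, norm_mul, norm_mul, Complex.norm_I, mul_one, Complex.norm_real,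
          Real.norm_eq_abs, Complex.norm_real, Real.norm_eq_abs, abs_of_pos Real.pi_pos]
        norm_cast

/-- `‖𝔣𝔣_{j7}(w)‖ ≤ 6` for `|w| ≤ 1` (`𝔣𝔣_{j7} = 𝔣𝔣_{a,5/2}` with `a ∈ {3/2, 1/2, −1/2}`).
[cite: Zhang2022LandauSiegel, §8 (8.16)–(8.18)] -/
theorem norm_ffJ7_le (j : ℕ) {w : ℝ} (hw : |w| ≤ 1) : ‖ffJ7 j w‖ ≤ 6 := by
  have hπ := Real.pi_lt_d2
  have key : ∀ a k : ℚ, |(a : ℝ)| ≤ 3 / 2 → ‖ffF a k w‖ ≤ 6 := by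
    intro a k ha
    refine (norm_ffF_le a k w).trans ?_
    have h1 : |(a : ℝ)| * π ≤ 3 / 2 * 3.15 := mul_le_mul ha hπ.le Real.pi_pos.le (by norm_num)
    have h2 : |(a : ℝ)| * π * |w| ≤ 3 / 2 * 3.15 * 1 :=
      mul_le_mul h1 hw (abs_nonneg _) (by norm_num)
    linarith
  unfold ffJ7 byJ ff17 ff27 ff37
  split_ifs
  · exact key _ _ (by norm_num)
  · exact key _ _ (by norm_num)
  · exact key _ _ (by norm_num [abs_of_nonpos])

/-- `𝔣_{j7}(P^{0.5}/P^z) = 𝔣(β_j, β₇; (0.5 − z)·log P)` (the profile at `t = P^z` in the tree's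
`frakf` variables). [cite: Zhang2022LandauSiegel, §8 Lemma 8.2] -/
theorem frakfW7_at_rpow (c' : ℝ) (D j : ℕ) (z : ℝ) :
    frakfW c' D j 7 (bigP D ^ (0.5 : ℝ) / bigP D ^ z) =
      frakf (betaJ c' D j) (beta7 D) ((Real.log (bigP D) : ℂ) * (((0.5 - z : ℝ)) : ℂ)) := by
  have hP : 0 < bigP D := Real.exp_pos _
  have h7 : betaMu D 7 = beta7 D := by norm_num [betaMu]
  rw [frakfW, h7, ← Real.rpow_sub hP, Real.log_rpow hP]
  congr 1
  rw [Complex.ofReal_mul, mul_comm]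

/-- The `u = 0.5 − z` substitution for the top range: `∫_{0.498}^{0.5} H(0.5 − z)dz = ∫₀^{0.002} H(u)du`.
[cite: Zhang2022LandauSiegel, §10 p. 61] -/
theorem integral_top_reflect (H : ℝ → ℂ) :
    ∫ z in (0.498 : ℝ)..0.5, H (0.5 - z) = ∫ u in (0 : ℝ)..0.002, H u := by
  rw [intervalIntegral.integral_comp_sub_left H (0.5 : ℝ)]
  norm_num

/-- `P^{0.5} + 1 ≤ P` and `1 ≤ P^{0.5} ≤ P` for `𝓛 ≥ 2`. [cite: Zhang2022LandauSiegel, §2 (2.6)] -/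
theorem sqrtP_facts {D : ℕ} (hℓ : 2 ≤ ell D) :
    1 ≤ bigP D ^ (0.5 : ℝ) ∧ bigP D ^ (0.5 : ℝ) ≤ bigP D ∧ bigP D ^ (0.5 : ℝ) + 1 ≤ bigP D := by
  have hℓ0 : 0 < ell D := by linarith
  have hℓ1 : 1 ≤ ell D := by linarith
  have hP1 : 1 < bigP D := by rw [bigP]; exact Real.one_lt_exp_iff.2 (pow_pos hℓ0 9)
  refine ⟨Real.one_le_rpow hP1.le (by norm_num), ?_, ?_⟩
  · calc bigP D ^ (0.5 : ℝ) ≤ bigP D ^ (1 : ℝ) :=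
          Real.rpow_le_rpow_of_exponent_le hP1.le (by norm_num)
      _ = bigP D := Real.rpow_one _
  · exact rpow_add_one_le_bigP (by norm_num) (by norm_num) hℓ1 (by nlinarith)

/-! ### Z22:§10.u057 (ii) -/

/-- **Z22:§10.u057 (ii) HOLDS** [Z22 p.61, tex L3101, second line]: `Top1214Int c′` — "`… =
(1000ῑ₄𝔞/log P)∫₀^{0.002}𝔣𝔣_{j7}(z)(1 + 𝔶𝔶_{2j}(0.504 − z))dz + o(α)`", i.e. for every `ε > 0`, all
large `D`, every real primitive `χ (mod D)` satisfying (A) and `j ∈ {1,2,3}`: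
`‖topSum1214 − topInt1214‖ ≤ εα`. Proof: `lamAvg_second_line` with `κ = 1000ῑ₄`, the window
`[P^{0.498}, P^{0.5}]`, the profile `𝔣_{j7}(P^{0.5}/t)(1 + 𝔶_{2j}(P^{0.004}t))` (`topProfile_bounds`),
the main values `𝔣𝔣_{j7}(0.5 − z)(1 + 𝔶𝔶_{2j}(z + 0.004))` (`norm_frakf_sub_ffJ`, sz-d34;
`Typed.Sec10A.step10u024_holds`, Z22:§10.u024 — the only place (A) enters, as that node is typed
under (A)), and the substitution `u = 0.5 − z`. Error `O_{c′}(𝓛⁻¹²) = o(α)`.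
[cite: Zhang2022LandauSiegel, §10 p. 61, tex L3101] -/
theorem top1214Int_holds (c' : ℝ) : Top1214Int c' := by
  intro ε hε
  obtain ⟨C₂₄, h24⟩ := Sec10A.step10u024_holds c'
  set C₀ : ℝ := 161 * (5 * π ^ 2 * |c'|) + 6 * |C₂₄| with hC₀
  have hC₀0 : 0 ≤ C₀ := by positivity
  have hgen := lamAvg_second_line c' (1000 * conj iota4) (a := 0.498) (b := 0.5) (M := 4669)
    (M' := 17222) (C₀ := C₀) (by norm_num) (by norm_num) (by norm_num) (by norm_num) (by norm_num)
    hC₀0 ε hε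
  have h5 := forAllLarge_ell_six (5 * c')
  refine ((hgen.and h24).and h5).mono ?_
  intro D _ χ hq hp ⟨⟨hG, h24D⟩, hℓ6, hc5⟩ hA j hj
  -- parameters
  have hℓ0 : 0 < ell D := by linarith
  have hℓ1 : 1 ≤ ell D := by linarith
  have hP : 0 < bigP D := Real.exp_pos _
  have hP1 : 1 < bigP D := by rw [bigP]; exact Real.one_lt_exp_iff.2 (pow_pos hℓ0 9)
  have hlogP : Real.log (bigP D) = ell D ^ 9 := by rw [bigP, Real.log_exp]
  have hΛ : 0 < Real.log (bigP D) := by rw [hlogP]; positivity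
  have hα : 0 < alpha D := alpha_pos hΛ
  have hαℓ : alpha D * ell D = π / ell D ^ 8 := alpha_mul_ell hℓ0
  have hΛ4 : alpha D * Real.log (bigP D) ≤ 4 := by
    rw [alpha, div_mul_cancel₀ _ hΛ.ne']; linarith [Real.pi_lt_d2]
  have hc : 5 * |c'| * alpha D * ell D ≤ 1 := by
    have : |5 * c'| = 5 * |c'| := by rw [abs_mul, abs_of_pos (by norm_num : (0:ℝ) < 5)]
    rw [this] at hc5; linarith [hc5]
  obtain ⟨hQ1, hQP, hQP1⟩ := sqrtP_facts (D := D) (by linarith)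
  have hlo1 : 1 ≤ bigP D ^ (0.498 : ℝ) := Real.one_le_rpow hP1.le (by norm_num)
  -- the profile and its main value
  set F : ℝ → ℂ := fun t => frakfW c' D j 7 (bigP D ^ (0.5 : ℝ) / t) *
    (1 + fraky2 c' D j (bigP D ^ (0.004 : ℝ) * t)) with hF
  set H : ℝ → ℂ := fun u => ffJ7 j u * (1 + yyJ2 j (0.504 - u)) with hH
  set G₀ : ℝ → ℂ := fun z => H (0.5 - z) with hG₀
  have hprof : ∀ t : ℝ, bigP D ^ (0.498 : ℝ) ≤ t → t ≤ bigP D ^ (0.5 : ℝ) + 1 →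
      DifferentiableAt ℝ F t ∧ ‖F t‖ ≤ 4669 ∧ ‖deriv F t‖ ≤ 17222 * alpha D / t := by
    intro t h1 h2
    exact topProfile_bounds c' j hα hℓ0.le hc (hlo1.trans h1) (h2.trans hQP1) hΛ4 hQ1 hQP
  have hG₀i : IntervalIntegrable G₀ volume (0.498 : ℝ) 0.5 := by
    apply Continuous.intervalIntegrable
    rw [hG₀, hH]
    fun_prop
  have happrox : ∀ z ∈ Set.Icc (0.498 : ℝ) 0.5, ‖F (bigP D ^ z) - G₀ z‖ ≤ C₀ / ell D ^ 8 := by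
    intro z hz
    obtain ⟨hz1, hz2⟩ := hz
    -- the two factors and their main values
    set f : ℂ := frakfW c' D j 7 (bigP D ^ (0.5 : ℝ) / bigP D ^ z) with hf
    set g : ℂ := 1 + fraky2 c' D j (bigP D ^ (0.004 : ℝ) * bigP D ^ z) with hg
    set f₀ : ℂ := ffJ7 j (0.5 - z) with hf₀
    set g₀ : ℂ := 1 + yyJ2 j (0.504 - (0.5 - z)) with hg₀
    have eF : F (bigP D ^ z) - G₀ z = (f - f₀) * g + f₀ * (g - g₀) := by
      simp only [hF, hG₀, hH, hf, hg, hf₀, hg₀]; ring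
    -- `‖f − f₀‖ ≤ 5π²|c′|𝓛⁻⁸`
    have hff : ‖f - f₀‖ ≤ 5 * π ^ 2 * |c'| / ell D ^ 8 := by
      rw [hf, hf₀, frakfW7_at_rpow]
      refine (norm_frakf_sub_ffJ (c' := c') hΛ hj (0.5 - z)).2.trans ?_
      have hw : |(0.5 : ℝ) - z| ≤ 1 := by rw [abs_le]; constructor <;> linarith
      have hu : |c' * alpha D * ell D| = |c'| * (π / ell D ^ 8) := by
        rw [mul_assoc, abs_mul, hαℓ, abs_of_pos (show (0:ℝ) < π / ell D ^ 8 by positivity)]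
      rw [hu]
      calc 5 * π * (|c'| * (π / ell D ^ 8)) * |(0.5 : ℝ) - z|
          ≤ 5 * π * (|c'| * (π / ell D ^ 8)) * 1 := by gcongr
        _ = 5 * π ^ 2 * |c'| / ell D ^ 8 := by ring
    -- `‖g‖ ≤ 161`
    have hgn : ‖g‖ ≤ 161 := by
      have hPz1 : 1 ≤ bigP D ^ z := Real.one_le_rpow hP1.le (by linarith)
      have hPzP : bigP D ^ z ≤ bigP D := by
        calc bigP D ^ z ≤ bigP D ^ (1 : ℝ) := Real.rpow_le_rpow_of_exponent_le hP1.le (by linarith)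
          _ = bigP D := Real.rpow_one _
      exact (y2Profile_bounds c' j hα hℓ0.le hc hPz1 hPzP hΛ4 hQ1 hQP).2.1
    -- `‖f₀‖ ≤ 6`
    have hf₀n : ‖f₀‖ ≤ 6 := norm_ffJ7_le j (by rw [abs_le]; constructor <;> linarith)
    -- `‖g − g₀‖ ≤ |C₂₄|𝓛⁻⁸` (Z22:§10.u024 at `w = z + 0.004`)
    have hgg : ‖g - g₀‖ ≤ |C₂₄| / ell D ^ 8 := by
      have hw0 : (0 : ℝ) ≤ 0.504 - (0.5 - z) := by linarith
      have hw1 : 0.504 - (0.5 - z) ≤ (1 : ℝ) := by linarith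
      have h := (h24D hA j hj (0.504 - (0.5 - z)) hw0 hw1).2
      have ew : bigP D ^ (0.004 : ℝ) * bigP D ^ z = bigP D ^ ((0.504 : ℝ) - (0.5 - z)) := by
        rw [← Real.rpow_add hP]; congr 1; ring
      have eg : g - g₀ = fraky2 c' D j (bigP D ^ ((0.504 : ℝ) - (0.5 - z))) -
          (if j = 1 then yy21 (0.504 - (0.5 - z)) else if j = 2 then yy22 (0.504 - (0.5 - z))
            else yy23 (0.504 - (0.5 - z))) := by
        rw [hg, hg₀, ew, yyJ2_apply]; ring
      rw [eg]
      refine h.trans ?_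
      rw [← div_eq_mul_inv]
      gcongr
      exact le_abs_self _
    rw [eF]
    calc ‖(f - f₀) * g + f₀ * (g - g₀)‖ ≤ ‖f - f₀‖ * ‖g‖ + ‖f₀‖ * ‖g - g₀‖ := by
          refine (norm_add_le _ _).trans ?_; rw [norm_mul, norm_mul]
      _ ≤ 5 * π ^ 2 * |c'| / ell D ^ 8 * 161 + 6 * (|C₂₄| / ell D ^ 8) :=
          add_le_add (mul_le_mul hff hgn (norm_nonneg _) (by positivity))
            (mul_le_mul hf₀n hgg (norm_nonneg _) (by norm_num))
      _ = C₀ / ell D ^ 8 := by rw [hC₀]; ring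
  -- the engine
  have key := hG j F G₀ hprof hG₀i happrox
  have hsub : ∫ z in (0.498 : ℝ)..0.5, G₀ z = ∫ u in (0 : ℝ)..0.002, H u := by
    rw [hG₀]; exact integral_top_reflect H
  rw [hsub] at key
  have eS : topSum1214 c' χ j = 1000 * conj iota4 * deriv χ.LFunction 1 ^ 2 /
      (Real.log (bigP D) : ℂ) ^ 2 * lamAvg c' χ j (bigP D ^ (0.498 : ℝ)) (bigP D ^ (0.5 : ℝ))
        (fun n => F n) := by
    simp only [topSum1214, hF]
  have eI : topInt1214 χ j = 1000 * conj iota4 * (frakA χ : ℂ) / (Real.log (bigP D) : ℂ) *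
      ∫ u in (0 : ℝ)..0.002, H u := by
    simp only [topInt1214, hH]
  rw [eS, eI]
  exact key

variable (c' : ℝ) in
/-- `Top1214Int` — `_holds` alias of `top1214Int_holds` above under the fact's exact name, stated under the
prover's own binders as section variables (appended 2026-08-28, D-0026 bookkeeping: the proof term is the
existing theorem of this file; no statement, definition or attribute is edited; no new named fact; the
ledger's debt table listed the fact unproved). [cite: Zhang2022LandauSiegel, §10 p. 61, tex L3101] -/
theorem _root_.Literature.NumberTheory.LFunctions.Zhang2022.Typed.Sec10C.Top1214Int_holds :
    _root_.Literature.NumberTheory.LFunctions.Zhang2022.Typed.Sec10C.Top1214Int c' :=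
  _root_.Literature.NumberTheory.LFunctions.Zhang2022.Typed.Sec10C.top1214Int_holds (c' := c')

end D39Top1214Int

end Literature.NumberTheory.LFunctions.Zhang2022.Typed.Sec10C
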